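import Mathlib
import Literature.NumberTheory.LFunctions.Zhang2022.Section8Lemma81FromProp22
import Literature.NumberTheory.LFunctions.Zhang2022.Section13ConjugateAFE
import Literature.NumberTheory.LFunctions.Zhang2022.Section15ResidueParams
import Literature.NumberTheory.LFunctions.Zhang2022.Section15ResidueNonvanishing
import HarnessLib

/-!
# Zhang (2022), §13 (13.11): the `L₂L₃` mean square on the LEFT segment `𝒥(−α)` (item I3-LL)

ZHANG-L WP14, helper under leaf `h1311` `Skeleton.Eq1311Rel c′ c137` (owner zl-w14-p5); item **I3-LL**
of the WP14 §13 signature scratch v5 (zl-w14-typer) = the leaf owner's SYNC ask (3), used ONLY in the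
`t₀⁻¹`-paying term S1 of the bound for `𝓔` in (13.11) (so the `P²`-form is affordable there, CL-9).

Source sentence (§13 p.75, tex L3810–3817, the estimate of `𝓔`): "by (2.34), Cauchy's inequality,
Proposition 7.1, Lemma 5.9, 6.1 and 3.3 …". The mean value needed on BOTH segments `𝒥(±α)` of the
residue conversion (2.34) is the §8 p.43 display `Z22:§8.u013`
  `Σ_{ψ∈Ψ₁} |L(s+β₂,ψ)L(s+β₃,ψ)|² ≪ P²𝓛³⁶`,
which the tree proves for `s ∈ 𝒥(α)` (`Section8aStatements.step8u013_holds`, unconditional). This file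
transports it to `s ∈ 𝒥(−α)` by the functional equation (2.2): for `ψ ∈ Ψ` and `w` on Lemma 6.1's range
(`|Re w − ½| ≤ 2α`, `|Im w − 2πt₀| < 𝓛₁ + 2`),
  `L(w,ψ) = Z(w,ψ)·L(1−w,ψ̄) = Z(w,ψ)·\overline{L(1−w̄,ψ)}`, `|Z(w,ψ)| ≤ e¹⁶`
(tree: `GammaFactor.LFunction_eq_Zfac_mul`, `Typed.Section13.LFunction_inv_conj`,
`Section6Statements.norm_Zfac_le_exp_sixteen`), hence `|L(w,ψ)| ≤ e¹⁶|L(1−w̄,ψ)|`; and for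
`s = −α + s₀ + iv` one has `1 − \overline{s+β_j} = α + s₀ + iv + β_j` (`β_j ∈ iℝ`), a point of `𝒥(α) + β_j`.
So the left-segment mean square is at most `e⁶⁴` times the right-segment one.

Main results (namespace `…Zhang2022.Typed.Section13`):
* `norm_LFunction_le_exp16_mul_norm_reflect` — `‖L(σ+it,ψ)‖ ≤ e¹⁶‖L(1−σ+it,ψ)‖` on Lemma 6.1's range;
* `norm_LFunction_negJ_shift_le` — `‖L(−α+s₀+iv+ib,ψ)‖ ≤ e¹⁶‖L(α+s₀+iv+ib,ψ)‖` (`|v| ≤ 𝓛₁`, `|b| < 2`);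
* `meanSq_L23_le_onJ_neg` — the scratch-v5 statement VERBATIM (v-form);
* `meanSq_L23_le_onJ_neg'` — the same in the `onJ D (−alpha D) s` form of `Step8u013`;
* `meanSq_L23_le_onJ_both` — both segments at once (`z ∈ {α, −α}`), one constant.

Theorems only; no definitions; axioms standard. Honest framing: kernel theorems about typed-as-printed
statements of an unrefereed manuscript; nothing about Landau–Siegel zeros follows from this file.

[cite: Zhang2022LandauSiegel, §13 p.75 (13.11), tex L3810–3817; §8 p.43 (§8.u013), tex L2244–2247;
§2 (2.2) p.4; §6 Lemma 6.1 p.31; §5 Lemma 5.1]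
-/

noncomputable section

open Complex Real ComplexConjugate

namespace Literature.NumberTheory.LFunctions.Zhang2022.Typed.Section13

open Skeleton GammaFactor Section8aStatements

/-! ## Pointwise reflection across the critical line -/

/-- `1 − \overline{(σ + it)} = (1 − σ) + it` for real `σ, t`. [folklore] -/
private theorem one_sub_conj_ofReal_add_mul_I (σ t : ℝ) :
    1 - conj ((σ : ℂ) + t * I) = ((1 - σ : ℝ) : ℂ) + t * I := by
  apply Complex.ext <;> simp

/-- **Reflection bound** `‖L(σ+it,ψ)‖ ≤ e¹⁶·‖L((1−σ)+it,ψ)‖` for `ψ ∈ Ψ`, `𝓛 ≥ 3`, on Lemma 6.1's range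
`|σ − ½| ≤ 2α`, `|t − 2πt₀| < 𝓛₁ + 2`: by (2.2) `L(w,ψ) = Z(w,ψ)L(1−w,ψ̄)`, `L(1−w,ψ̄) = \overline{L(1−w̄,ψ)}`
and `|Z(w,ψ)| ≤ e¹⁶`. [cite: Zhang2022LandauSiegel, §2 (2.2) p.4; §6 Lemma 6.1 p.31] -/
theorem norm_LFunction_le_exp16_mul_norm_reflect {D : ℕ} (x : Chr D) (hL : 3 ≤ ell D) {σ t : ℝ}
    (hσ : |σ - 1 / 2| ≤ 2 * alpha D) (ht : |t - 2 * π * t0 D| < ell1 D + 2) :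
    ‖x.ψ.LFunction ((σ : ℂ) + t * I)‖ ≤
      Real.exp 16 * ‖x.ψ.LFunction (((1 - σ : ℝ) : ℂ) + t * I)‖ := by
  have ht' : |t - 2 * π * ell D ^ 519| < ell D ^ 405 + 2 := by simpa only [t0, ell1] using ht
  obtain ⟨ht5, -⟩ := Section6Statements.t_range hL ht'
  have hL0 : 0 < ell D := by linarith
  have htpos : 0 < t := lt_of_lt_of_le (by positivity) ht5
  have him : (((σ : ℂ) + t * I)).im ≠ 0 := by
    have : (((σ : ℂ) + t * I)).im = t := by simp
    rw [this]; exact htpos.ne'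
  have hFE := LFunction_eq_Zfac_mul x.prim x.p_ne_one (s := (σ : ℂ) + t * I) him
  have hZ : ‖Zfac x.ψ ((σ : ℂ) + t * I)‖ ≤ Real.exp 16 :=
    Section6Statements.norm_Zfac_le_exp_sixteen x hL hσ ht'
  rw [hFE, norm_mul, LFunction_inv_conj x (1 - ((σ : ℂ) + t * I)), Complex.norm_conj, map_sub,
    map_one, ← one_sub_conj_ofReal_add_mul_I σ t]
  exact mul_le_mul_of_nonneg_right hZ (norm_nonneg _)

/-- The points of the two segments: `∓α + s₀ + iv + ib = (½ ∓ α) + i(2πt₀ + v + b)`.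
[cite: Zhang2022LandauSiegel, §7 p.33 (the segments `𝒥(±α)`); §2 (2.13)] -/
theorem segment_point_eq {D : ℕ} (z v b : ℝ) :
    ((z : ℝ) : ℂ) + s0 D + v * I + (b : ℂ) * I =
      ((1 / 2 + z : ℝ) : ℂ) + ((2 * π * t0 D + v + b : ℝ) : ℂ) * I := by
  rw [s0, SmoothWeight.s0_def]
  push_cast
  ring

/-- **Left-to-right transport, one shift.** For `ψ ∈ Ψ`, `𝓛 ≥ 3`, `|v| ≤ 𝓛₁`, a real shift size
`|b| < 2`, and `0 < α` with `α ≤ 2α`-clearance automatic: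
`‖L(−α+s₀+iv+ib,ψ)‖ ≤ e¹⁶·‖L(α+s₀+iv+ib,ψ)‖` (the reflection `w ↦ 1 − w̄` maps `𝒥(−α)+ib` onto `𝒥(α)+ib`).
[cite: Zhang2022LandauSiegel, §2 (2.2); §6 Lemma 6.1; §8 p.43] -/
theorem norm_LFunction_negJ_shift_le {D : ℕ} (x : Chr D) (hL : 3 ≤ ell D) (hα : 0 ≤ alpha D)
    {v b : ℝ} (hv : |v| ≤ ell1 D) (hb : |b| < 2) :
    ‖x.ψ.LFunction (((-alpha D : ℝ) : ℂ) + s0 D + v * I + (b : ℂ) * I)‖ ≤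
      Real.exp 16 * ‖x.ψ.LFunction ((alpha D : ℂ) + s0 D + v * I + (b : ℂ) * I)‖ := by
  have h1 := segment_point_eq (D := D) (-alpha D) v b
  have h2 := segment_point_eq (D := D) (alpha D) v b
  have hσ : |(1 / 2 + -alpha D) - 1 / 2| ≤ 2 * alpha D := by
    rw [show (1 / 2 + -alpha D) - 1 / 2 = -alpha D by ring, abs_neg, abs_of_nonneg hα]; linarith
  have ht : |(2 * π * t0 D + v + b) - 2 * π * t0 D| < ell1 D + 2 := by
    rw [show (2 * π * t0 D + v + b) - 2 * π * t0 D = v + b by ring]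
    exact lt_of_le_of_lt (abs_add_le v b) (by linarith)
  have h := norm_LFunction_le_exp16_mul_norm_reflect x hL hσ ht
  rw [show (1 - (1 / 2 + -alpha D) : ℝ) = 1 / 2 + alpha D by ring] at h
  have h2' : ((alpha D : ℝ) : ℂ) + s0 D + v * I + (b : ℂ) * I =
      ((1 / 2 + alpha D : ℝ) : ℂ) + ((2 * π * t0 D + v + b : ℝ) : ℂ) * I := h2
  rw [h1, h2']
  exact h

/-! ## The mean square on `𝒥(−α)` -/

/-- Thresholds used below: for `D ≥ max ⌈e³⌉ ⌈e^{14|c′|π}⌉`, `𝓛 ≥ 3`, `0 ≤ α`, and the shift sizes of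
`β₂ = ib₂`, `β₃ = ib₃` satisfy `|b₂|, |b₃| < 2` (indeed `≤ 4α ≤ 2/3`).
[cite: Zhang2022LandauSiegel, §2 (2.10), (2.13)] -/
theorem shifts_small (c' : ℝ) {D : ℕ}
    (hD : max ⌈Real.exp 3⌉₊ ⌈Real.exp (14 * |c'| * π)⌉₊ ≤ D) :
    3 ≤ ell D ∧ 0 ≤ alpha D ∧ |b2 c' D| < 2 ∧ |b3 c' D| < 2 := by
  obtain ⟨hL, he⟩ := ResidueValues.thresholds c' hD
  obtain ⟨hα0, hα6, -⟩ := Step8u016.alpha_small hL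
  obtain ⟨-, e2, e3⟩ := beta_eq_b_mul_I c' D
  have n2 := ResidueValues.norm_beta2_le c' hL he
  have n3 := ResidueValues.norm_beta3_le c' hL he
  rw [e2, norm_mul, Complex.norm_I, mul_one, Complex.norm_real, Real.norm_eq_abs] at n2
  rw [e3, norm_mul, Complex.norm_I, mul_one, Complex.norm_real, Real.norm_eq_abs] at n3
  exact ⟨hL, hα0.le, by linarith, by linarith⟩

/-- **I3-LL (WP14 §13 scratch v5, VERBATIM): the `L₂L₃` mean square on `𝒥(−α)`.** For every `c′`
there is `C` such that for all large `D`, under (A), for `|v| ≤ 𝓛₁`,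
`Σ_{ψ∈Ψ₁} |L(−α+s₀+iv+β₂,ψ)·L(−α+s₀+iv+β₃,ψ)|² ≤ C·P²·𝓛³⁶`.
Proof: pointwise `|L(−α+s₀+iv+β_j,ψ)| ≤ e¹⁶|L(α+s₀+iv+β_j,ψ)|` (`norm_LFunction_negJ_shift_le`), then
`Z22:§8.u013` on `𝒥(α)` (`Section8aStatements.step8u013_holds`); `C = e⁶⁴·C₈.u013`.
[cite: Zhang2022LandauSiegel, §13 p.75 (13.11), tex L3810–3817; §8 p.43 (§8.u013), tex L2244–2247] -/
theorem meanSq_L23_le_onJ_neg (c' : ℝ) : ∃ C : ℝ, ForAllLarge fun D _ χ => AssumptionA D χ →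
    ∀ v : ℝ, |v| ≤ ell1 D →
      ∑ x ∈ finsetOf (PsiOne χ),
          ‖x.ψ.LFunction (((-alpha D : ℝ) : ℂ) + s0 D + v * I + beta2 c' D) *
              x.ψ.LFunction (((-alpha D : ℝ) : ℂ) + s0 D + v * I + beta3 c' D)‖ ^ 2 ≤
        C * bigP D ^ 2 * ell D ^ 36 := by
  obtain ⟨C, D₀, h8⟩ := step8u013_holds c'
  refine ⟨Real.exp 16 ^ 4 * C, max D₀ (max ⌈Real.exp 3⌉₊ ⌈Real.exp (14 * |c'| * π)⌉₊),
    fun D _ χ hD hq hp hA v hv => ?_⟩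
  have hD₀ : D₀ ≤ D := le_trans (le_max_left _ _) hD
  obtain ⟨hL, hα, hb2, hb3⟩ := shifts_small c' (le_trans (le_max_right _ _) hD)
  obtain ⟨-, e2, e3⟩ := beta_eq_b_mul_I c' D
  -- §8.u013 on `𝒥(α)` at `s' = α + s₀ + iv`
  have hs' : onJ D (alpha D) ((alpha D : ℂ) + s0 D + v * I) := ⟨v, hv, rfl⟩
  have hmain := h8 D χ hD₀ hq hp hA _ hs'
  -- pointwise transport
  have hpt : ∀ x : Chr D,
      ‖x.ψ.LFunction (((-alpha D : ℝ) : ℂ) + s0 D + v * I + beta2 c' D) *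
          x.ψ.LFunction (((-alpha D : ℝ) : ℂ) + s0 D + v * I + beta3 c' D)‖ ^ 2 ≤
        Real.exp 16 ^ 4 *
          ‖x.ψ.LFunction ((alpha D : ℂ) + s0 D + v * I + beta2 c' D) *
            x.ψ.LFunction ((alpha D : ℂ) + s0 D + v * I + beta3 c' D)‖ ^ 2 := by
    intro x
    have g2 := norm_LFunction_negJ_shift_le x hL hα hv hb2
    have g3 := norm_LFunction_negJ_shift_le x hL hα hv hb3
    rw [← e2] at g2
    rw [← e3] at g3
    rw [norm_mul, norm_mul]
    have n2 := norm_nonneg (x.ψ.LFunction (((-alpha D : ℝ) : ℂ) + s0 D + v * I + beta2 c' D))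
    have n3 := norm_nonneg (x.ψ.LFunction (((-alpha D : ℝ) : ℂ) + s0 D + v * I + beta3 c' D))
    have hprod := mul_le_mul g2 g3 n3 (by positivity)
    calc (‖x.ψ.LFunction (((-alpha D : ℝ) : ℂ) + s0 D + v * I + beta2 c' D)‖ *
            ‖x.ψ.LFunction (((-alpha D : ℝ) : ℂ) + s0 D + v * I + beta3 c' D)‖) ^ 2
        ≤ (Real.exp 16 * ‖x.ψ.LFunction ((alpha D : ℂ) + s0 D + v * I + beta2 c' D)‖ *
            (Real.exp 16 * ‖x.ψ.LFunction ((alpha D : ℂ) + s0 D + v * I + beta3 c' D)‖)) ^ 2 :=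
          pow_le_pow_left₀ (by positivity) hprod 2
      _ = _ := by ring
  calc ∑ x ∈ finsetOf (PsiOne χ),
          ‖x.ψ.LFunction (((-alpha D : ℝ) : ℂ) + s0 D + v * I + beta2 c' D) *
              x.ψ.LFunction (((-alpha D : ℝ) : ℂ) + s0 D + v * I + beta3 c' D)‖ ^ 2
      ≤ ∑ x ∈ finsetOf (PsiOne χ), Real.exp 16 ^ 4 *
          ‖x.ψ.LFunction ((alpha D : ℂ) + s0 D + v * I + beta2 c' D) *
            x.ψ.LFunction ((alpha D : ℂ) + s0 D + v * I + beta3 c' D)‖ ^ 2 :=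
        Finset.sum_le_sum fun x _ => hpt x
    _ = Real.exp 16 ^ 4 * ∑ x ∈ finsetOf (PsiOne χ),
          ‖x.ψ.LFunction ((alpha D : ℂ) + s0 D + v * I + beta2 c' D) *
            x.ψ.LFunction ((alpha D : ℂ) + s0 D + v * I + beta3 c' D)‖ ^ 2 := by
        rw [Finset.mul_sum]
    _ ≤ Real.exp 16 ^ 4 * (C * bigP D ^ 2 * ell D ^ 36) :=
        mul_le_mul_of_nonneg_left hmain (by positivity)
    _ = Real.exp 16 ^ 4 * C * bigP D ^ 2 * ell D ^ 36 := by ring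

/-- **I3-LL in the `onJ` form of `Step8u013`:** for every `c′` there is `C` with, for all large `D`,
under (A), for every `s ∈ 𝒥(−α)` (`Section8aStatements.onJ D (−α) s`),
`Σ_{ψ∈Ψ₁} |L(s+β₂,ψ)L(s+β₃,ψ)|² ≤ C·P²·𝓛³⁶` — the exact left-segment twin of `Step8u013 c′`.
[cite: Zhang2022LandauSiegel, §13 p.75 (13.11); §8 p.43 (§8.u013), tex L2244–2247] -/
theorem meanSq_L23_le_onJ_neg' (c' : ℝ) : ∃ C : ℝ, ForAllLarge fun D _ χ => AssumptionA D χ →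
    ∀ s : ℂ, onJ D (-alpha D) s →
      ∑ x ∈ finsetOf (PsiOne χ),
          ‖x.ψ.LFunction (s + beta2 c' D) * x.ψ.LFunction (s + beta3 c' D)‖ ^ 2 ≤
        C * bigP D ^ 2 * ell D ^ 36 := by
  obtain ⟨C, D₀, h⟩ := meanSq_L23_le_onJ_neg c'
  refine ⟨C, D₀, fun D _ χ hD hq hp hA s hs => ?_⟩
  obtain ⟨v, hv, rfl⟩ := hs
  exact h D χ hD hq hp hA v hv

/-- **Both segments at once.** For every `c′` there is ONE `C` with, for all large `D`, under (A), for
`z ∈ {α, −α}` and every `s ∈ 𝒥(z)`, `Σ_{ψ∈Ψ₁} |L(s+β₂,ψ)L(s+β₃,ψ)|² ≤ C·P²·𝓛³⁶`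
(`Step8u013` on `𝒥(α)` and `meanSq_L23_le_onJ_neg'` on `𝒥(−α)`, larger constant / threshold).
[cite: Zhang2022LandauSiegel, §13 p.75 (13.11); §8 p.43 (§8.u013)] -/
theorem meanSq_L23_le_onJ_both (c' : ℝ) : ∃ C : ℝ, ForAllLarge fun D _ χ => AssumptionA D χ →
    ∀ z : ℝ, (z = alpha D ∨ z = -alpha D) → ∀ s : ℂ, onJ D z s →
      ∑ x ∈ finsetOf (PsiOne χ),
          ‖x.ψ.LFunction (s + beta2 c' D) * x.ψ.LFunction (s + beta3 c' D)‖ ^ 2 ≤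
        C * bigP D ^ 2 * ell D ^ 36 := by
  obtain ⟨C₁, D₁, h₁⟩ := step8u013_holds c'
  obtain ⟨C₂, D₂, h₂⟩ := meanSq_L23_le_onJ_neg' c'
  refine ⟨max C₁ C₂, max D₁ D₂, fun D _ χ hD hq hp hA z hz s hs => ?_⟩
  have hPL : 0 ≤ bigP D ^ 2 * ell D ^ 36 := by
    have : 0 ≤ ell D := by
      rw [ell]; exact Real.log_natCast_nonneg D
    positivity
  rcases hz with rfl | rfl
  · have h := h₁ D χ (le_trans (le_max_left _ _) hD) hq hp hA s hs
    calc _ ≤ C₁ * bigP D ^ 2 * ell D ^ 36 := h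
      _ = C₁ * (bigP D ^ 2 * ell D ^ 36) := by ring
      _ ≤ max C₁ C₂ * (bigP D ^ 2 * ell D ^ 36) :=
          mul_le_mul_of_nonneg_right (le_max_left _ _) hPL
      _ = _ := by ring
  · have h := h₂ D χ (le_trans (le_max_right _ _) hD) hq hp hA s hs
    calc _ ≤ C₂ * bigP D ^ 2 * ell D ^ 36 := h
      _ = C₂ * (bigP D ^ 2 * ell D ^ 36) := by ring
      _ ≤ max C₁ C₂ * (bigP D ^ 2 * ell D ^ 36) :=
          mul_le_mul_of_nonneg_right (le_max_right _ _) hPL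
      _ = _ := by ring

end Literature.NumberTheory.LFunctions.Zhang2022.Typed.Section13

end
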